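import Summits.ABC.Harvest.GlueGoldfeldSzpiro
import HarnessLib

/-!
# ABC harvest — glue G-20 (named inputs): Goldfeld–Szpiro Thm 2 with its conjectural input BY NAME

`Summits/ABC/Harvest/GlueGoldfeldSzpiroNamed.lean` — cell `abc-harv`, seat abc-harv-pr-3, namespace
`Summit.ABC.Harvest`. PROOF-ONLY companion of `GlueGoldfeldSzpiro.lean` (p552521) answering REF-B's
pre-referee criterion for G-20 (HOME/lanes/ref-2/REF-B.md §Pre-referee criteria, 2026-08-27T16:55Z):
the hypothesis `hBSD` of `polySzpiroRatEff_of_goldfeldSzpiroBound` («`r_an = 0 ⟹ Ш finite ∧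
L(E,1) ≤ #Ш·Ω·∏c_p`») is supplied from TWO NAMED tree statements —

* bin (T), printed THEOREM: bsd.S17 `Literature.NumberTheory.EllipticCurves.rank_eq_analyticRank_of_analyticRank_le_one`
  (Gross–Zagier–Kolyvagin: `r_an ≤ 1 ⟹ rank = r_an ∧ Ш(E/ℚ) finite`; undischarged named fact) — this is
  the finiteness that `GoldfeldSzpiroBound`'s guard `Finite W.sha` needs, so `shaOrder`'s junk value `0`
  never enters;
* bin (C), the ONE CONJECTURAL input: `Summit.ABC.Harvest.RankZeroBSDLowerShaBound` (OpenQuestions §10,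
  REF-B's sentence «`L(E_χ,1)·|E_χ,tors|² ≤ #Ш(E_χ)·Ω_χ·∏c_p`», the lower-`Ш` half of rank-`0` BSD —
  GS p. 76 (3.5); NOT Kolyvagin's direction);

and the two corollaries of `GlueGoldfeldSzpiro.lean` are restated with these names in place of `hBSD`.
The remaining inputs (`hP` period–discriminant, `hTam` Tamagawa, `hT` twist step with GS's `q ≤ N²`,
`Ω_χ = Ω_j/√q`) stay INLINE hypotheses with locators (bin (T), not yet typed under `Literature/`).
HONESTY: abc is not proved by any of this; A-PS is NOT abc — «NOT abc — POLY-SZPIRO(E ≈ 18)»; label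
«PROVED-MOD-FACTS (1 conjectural: `RankZeroBSDLowerShaBound`; 1 named printed theorem: bsd.S17; 3 printed
inputs inline)», rung ≥A-PS CONDITIONAL; typed ≠ proved.
-/

noncomputable section

open Literature.NumberTheory.EllipticCurves WeierstrassCurve

namespace Summit.ABC.Harvest

/-- `hBSD` of `polySzpiroRatEff_of_goldfeldSzpiroBound` from NAMED inputs: Gross–Zagier–Kolyvagin
(bsd.S17, finiteness of `Ш` in analytic rank `0`) and `RankZeroBSDLowerShaBound` (conjectural lower-`Ш`
half; `#E(ℚ)_tors ≥ 1` lets us drop the torsion factor). [cite: GoldfeldSzpiro1995, (3.5) p. 76 and p. 72] -/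
theorem lowerSha_of_grossZagierKolyvagin_of_rankZeroBSDLowerShaBound
    (hGZK : rank_eq_analyticRank_of_analyticRank_le_one) (hC : RankZeroBSDLowerShaBound) :
    ∀ (W : WeierstrassCurve ℚ) [W.IsElliptic] [W.IsGloballyMinimal], W.analyticRank = 0 →
      Finite W.sha ∧
        (W.leadingLCoeff).re ≤ (W.shaOrder : ℝ) * W.realPeriodRat * (W.tamagawaProduct : ℝ) := by
  intro W _ _ hr0
  obtain ⟨-, hfin⟩ := hGZK W (by omega)
  refine ⟨hfin, ?_⟩
  have h := hC W hr0
  have htors : (1 : ℝ) ≤ (W.torsionOrder : ℝ) := by exact_mod_cast W.torsionOrder_pos_holds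
  have hΩ : 0 < W.realPeriodRat := by
    haveI : (W.baseChange ℝ).IsElliptic := by rw [baseChange]; infer_instance
    rw [WeierstrassCurve.realPeriodRat_def]; exact (W.baseChange ℝ).realPeriod_pos'
  have hrhs : 0 ≤ (W.shaOrder : ℝ) * W.realPeriodRat * (W.tamagawaProduct : ℝ) := by positivity
  rcases le_or_gt 0 (W.leadingLCoeff).re with hL | hL
  · have ht2 : (1 : ℝ) ≤ (W.torsionOrder : ℝ) ^ 2 := one_le_pow₀ htors
    exact (le_mul_of_one_le_right hL ht2).trans h
  · linarith

/-- **G-20 with named inputs, GS's parameters** (`q ≤ c₈N²`, `L(E′,1) ≥ c₂`, `Ω′ ≤ c₇q^{-1/2}Ω`):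
`GoldfeldSzpiroBound` + bsd.S17 + `RankZeroBSDLowerShaBound` + (inline: period–discriminant, Tamagawa,
twist step) ⟹ `PolySzpiroRatEff (12(3/2 + 5ε + 12δ)/(1 − 12δ)) C` (`→ 18`), hence `PolySzpiroRat`.
NOT abc — POLY-SZPIRO(E ≈ 18); conditional as stated. [cite: GoldfeldSzpiro1995, Thm 2 (p. 75), proof pp. 76–77] -/
theorem polySzpiroRat_of_goldfeldSzpiroBound_named
    {ε δ c₁ c₂ c₃ c₅ c₆ c₇ c₈ : ℝ}
    (hε : 0 < ε) (hδ : 0 ≤ δ) (hδ' : 12 * δ < 1)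
    (hc₁ : 0 < c₁) (hc₂ : 0 < c₂) (hc₅ : 0 < c₅) (hc₆ : 0 < c₆) (hc₇ : 0 < c₇) (hc₈ : 0 < c₈)
    (hGS : GoldfeldSzpiroBound)
    (hGZK : rank_eq_analyticRank_of_analyticRank_le_one)
    (hC : RankZeroBSDLowerShaBound)
    (hP : ∀ (W : WeierstrassCurve ℚ) [W.IsElliptic] [W.IsGloballyMinimal],
      W.realPeriodRat * (W.minimalDiscriminantNorm ℤ : ℝ) ^ (1 / 12 : ℝ) ≤ c₃)
    (hTam : ∀ (W : WeierstrassCurve ℚ) [W.IsElliptic] [W.IsGloballyMinimal],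
      (W.tamagawaProduct : ℝ) ≤ c₅ * (W.minimalDiscriminantNorm ℤ : ℝ) ^ δ)
    (hT : ∀ (W : WeierstrassCurve ℚ) [W.IsElliptic] [W.IsGloballyMinimal],
      ∃ (W' : WeierstrassCurve ℚ) (q : ℝ), W'.IsElliptic ∧ W'.IsGloballyMinimal ∧
        1 ≤ q ∧ q ≤ c₈ * (W.conductorNorm ℤ : ℝ) ^ 2 ∧
        W'.analyticRank = 0 ∧
        c₂ ≤ (W'.leadingLCoeff).re ∧
        (W'.conductorNorm ℤ : ℝ) ≤ c₁ * q ^ 2 * (W.conductorNorm ℤ : ℝ) ∧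
        W'.realPeriodRat ≤ c₇ * q ^ (-(1 / 2) : ℝ) * W.realPeriodRat ∧
        (W'.minimalDiscriminantNorm ℤ : ℝ) ≤ c₆ * q ^ 6 * (W.minimalDiscriminantNorm ℤ : ℝ)) :
    ∃ C : ℝ, Summit.ABC.PolySzpiroRatEff (12 * (3 / 2 + 5 * ε + 12 * δ) / (1 - 12 * δ)) C ∧
      Summit.ABC.PolySzpiroRat :=
  polySzpiroRat_of_goldfeldSzpiroBound_GS hε hδ hδ' hc₁ hc₂ hc₅ hc₆ hc₇ hc₈ hGS
    (lowerSha_of_grossZagierKolyvagin_of_rankZeroBSDLowerShaBound hGZK hC) hP hTam hT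

/-- **G-20 with named inputs, RH(RS wt 3/2) reading** (`q ≤ c₈(α)N^α` for every `α > 0`, GS Thm 2
second clause «`ε′ = 13ε`»): `GoldfeldSzpiroBound` + bsd.S17 + `RankZeroBSDLowerShaBound` + (inline:
period–discriminant, Tamagawa for every `δ`, twist step for every `α`) ⟹ the tree's `SzpiroConjecture`
(Szpiro `6+ε`, A0-side currency). abc is not proved by this; conditional as stated.
[cite: GoldfeldSzpiro1995, Thm 2 (p. 75), second clause; proof p. 77] -/
theorem szpiro_of_goldfeldSzpiroBound_RH_named
    {c₁ c₂ c₃ c₆ c₇ : ℝ} (hc₁ : 0 < c₁) (hc₂ : 0 < c₂) (hc₆ : 0 < c₆) (hc₇ : 0 < c₇)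
    (hGS : GoldfeldSzpiroBound)
    (hGZK : rank_eq_analyticRank_of_analyticRank_le_one)
    (hC : RankZeroBSDLowerShaBound)
    (hP : ∀ (W : WeierstrassCurve ℚ) [W.IsElliptic] [W.IsGloballyMinimal],
      W.realPeriodRat * (W.minimalDiscriminantNorm ℤ : ℝ) ^ (1 / 12 : ℝ) ≤ c₃)
    (hTam : ∀ δ : ℝ, 0 < δ → ∃ c₅ : ℝ, 0 < c₅ ∧
      ∀ (W : WeierstrassCurve ℚ) [W.IsElliptic] [W.IsGloballyMinimal],
        (W.tamagawaProduct : ℝ) ≤ c₅ * (W.minimalDiscriminantNorm ℤ : ℝ) ^ δ)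
    (hT : ∀ α : ℝ, 0 < α → ∃ c₈ : ℝ, 0 < c₈ ∧
      ∀ (W : WeierstrassCurve ℚ) [W.IsElliptic] [W.IsGloballyMinimal],
      ∃ (W' : WeierstrassCurve ℚ) (q : ℝ), W'.IsElliptic ∧ W'.IsGloballyMinimal ∧
        1 ≤ q ∧ q ≤ c₈ * (W.conductorNorm ℤ : ℝ) ^ α ∧
        W'.analyticRank = 0 ∧
        c₂ ≤ (W'.leadingLCoeff).re ∧
        (W'.conductorNorm ℤ : ℝ) ≤ c₁ * q ^ 2 * (W.conductorNorm ℤ : ℝ) ∧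
        W'.realPeriodRat ≤ c₇ * q ^ (-(1 / 2) : ℝ) * W.realPeriodRat ∧
        (W'.minimalDiscriminantNorm ℤ : ℝ) ≤ c₆ * q ^ 6 * (W.minimalDiscriminantNorm ℤ : ℝ)) :
    SzpiroConjecture :=
  szpiro_of_goldfeldSzpiroBound_RH hc₁ hc₂ hc₆ hc₇ hGS
    (lowerSha_of_grossZagierKolyvagin_of_rankZeroBSDLowerShaBound hGZK hC) hP hTam hT

end Summit.ABC.Harvest
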